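import Mathlib
import HarnessLib

/-!
# FunctionalMining/NoGo — THEOREM R₁ (one-notch range collapse), arithmetic and combinatorial cores
# (authored by the no-go seat, cell `pub-nsfunc`, nogo gen 16, `COLLAPSE-ADDENDUM-3.md` ba8a66754e40fca5; filed verbatim by the prove seat, gen 12, staged sha16 87869c3408b01668 + docstrings)

Search for candidate a priori estimates; no regularity claim.

THEOREM R₁ (informal; exact straight-chord kinematics `dx/dy = −tan(mid)`, K-triple-only rule book with
equal-and-opposite satellites `±t` one notch below the mains `±d`, `0 < t < d`, `η = d − t`, y-periodic
orbits with at least one event, distortion `c = (k₂/k₁)·η/(d+t) < 1`):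
(T1) every `−d` main creates with strictly alternating chirality; (T2) the director range is `d` or `d+t`
at every height. Consequently K4′ restricted to one satellite size has no witness.

What is formalised here (everything elementary, `[ours]`):
* `descent_I_alpha`, `descent_II_alpha`, `descent_I_beta`, `descent_II_beta` — the four linear-arithmetic
  cases of the SPACING DESCENT lemma F10: from the rate-table consequences (I), (II), (α), (β) and `0 < c < 1`
  the spacing of the image occurrence is strictly smaller, `Δ' < Δ`.
* `no_strictly_decreasing_cycle` — a function on a finite type that strictly decreases along a permutation
  has no such permutation unless the type is empty (the combinatorial end of the proof of (T1)).
* `junction_identity` — lemma F11(b): with the junction relation between consecutive blocks, the difference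
  of block invariants equals half the sum of the two front signs facing the shared `+d` main.
* `block_window` — lemma F11(a): the four levels of a block lie in the window `[u, u + d + t]`.
Nothing is claimed about Navier–Stokes.
-/

noncomputable section

namespace Summit.NavierStokesRegularity.FunctionalMining.OneNotch

/-! ### F10: the four descent cases (pure linear arithmetic in the event heights) -/

/-- Case I ∧ α: `y_s − y_f ≤ c Δ` (I) and `Δ' ≤ c (y_s − y_f)` (α) give `Δ' ≤ c² Δ < Δ`. -/
theorem descent_I_alpha {c Δ Δ' yf ys : ℝ} (hc0 : 0 < c) (hc1 : c < 1) (hΔ : 0 < Δ)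
    (hI : ys - yf ≤ c * Δ) (hα : Δ' ≤ c * (ys - yf)) : Δ' < Δ := by
  have h1 : Δ' ≤ c * (c * Δ) := le_trans hα (by exact mul_le_mul_of_nonneg_left hI hc0.le)
  have h2 : c * (c * Δ) < Δ := by nlinarith [mul_pos hc0 hΔ]
  linarith

/-- Case II ∧ α: `θ_R ≤ c (y_f − y₀)` (II), `y_s = y₀' + θ_R`, `y₀ < y_f < y₀'`, and (α) give `Δ' ≤ c Δ < Δ`. -/
theorem descent_II_alpha {c Δ' y0 y0' yf ys θR : ℝ} (hc0 : 0 < c) (hc1 : c < 1)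
    (h0f : y0 < yf) (hf0' : yf < y0') (hys : ys = y0' + θR)
    (hII : θR ≤ c * (yf - y0)) (hα : Δ' ≤ c * (ys - yf)) : Δ' < y0' - y0 := by
  have h1 : ys - yf ≤ y0' - y0 := by nlinarith
  have h2 : Δ' ≤ c * (y0' - y0) := le_trans hα (mul_le_mul_of_nonneg_left h1 hc0.le)
  have h3 : c * (y0' - y0) < y0' - y0 := by nlinarith
  linarith

/-- Case I ∧ β: `y_s − y_f ≤ c Δ` (I), `θ_L ≥ (y_f − y_b)/c` (β), `y_b ≤ y_f`, `Δ' = y_s − θ_L − y_b`. -/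
theorem descent_I_beta {c Δ Δ' yb yf ys θL : ℝ} (hc0 : 0 < c) (hc1 : c < 1) (hΔ : 0 < Δ)
    (hbf : yb ≤ yf) (hI : ys - yf ≤ c * Δ) (hβ : (yf - yb) / c ≤ θL) (hΔ' : Δ' = ys - θL - yb) :
    Δ' < Δ := by
  have hq : (yf - yb) / c * c = yf - yb := div_mul_cancel₀ _ hc0.ne'
  have hq0 : 0 ≤ (yf - yb) / c := div_nonneg (by linarith) hc0.le
  have hinv : yf - yb ≤ (yf - yb) / c := by nlinarith
  have h1 : Δ' ≤ ys - yf := by linarith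
  have h2 : c * Δ < Δ := by nlinarith
  linarith

/-- Case II ∧ β: `θ_R ≤ c (y_f − y₀)`, `θ_L ≥ (y_f − y_b)/c`, `y₀ < y_f`, `y_b ≤ y_f`,
`Δ = y_s − θ_R − y₀`, `Δ' = y_s − θ_L − y_b` give `Δ' < Δ`. -/
theorem descent_II_beta {c Δ Δ' y0 yb yf ys θR θL : ℝ} (hc0 : 0 < c) (hc1 : c < 1)
    (h0f : y0 < yf) (hbf : yb ≤ yf) (hII : θR ≤ c * (yf - y0)) (hβ : (yf - yb) / c ≤ θL)
    (hΔ : Δ = ys - θR - y0) (hΔ' : Δ' = ys - θL - yb) : Δ' < Δ := by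
  have hq : (yf - yb) / c * c = yf - yb := div_mul_cancel₀ _ hc0.ne'
  have hq0 : 0 ≤ (yf - yb) / c := div_nonneg (by linarith) hc0.le
  have hA : 0 < yf - y0 := sub_pos.mpr h0f
  by_cases hb0 : yb ≤ y0
  · -- y_b ≤ y₀ : compare after multiplying by c
    have p1 : 0 < (yf - y0) * (1 - c) * (1 + c) :=
      mul_pos (mul_pos hA (sub_pos.mpr hc1)) (by linarith)
    have t1 : c * c * (yf - y0) < yf - y0 := by nlinarith [p1]
    have t2 : c * (y0 - yb) ≤ y0 - yb := by
      nlinarith [mul_nonneg (sub_nonneg.mpr hb0) (sub_pos.mpr hc1).le]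
    have e1 : c * (c * (yf - y0) + (y0 - yb)) = c * c * (yf - y0) + c * (y0 - yb) := by ring
    have key : c * (c * (yf - y0) + (y0 - yb)) < yf - yb := by linarith
    have h1 : c * (θR + y0 - yb) < c * θL := by nlinarith
    by_contra hcon
    have hle : θL ≤ θR + y0 - yb := by linarith [not_lt.mp hcon]
    nlinarith [mul_le_mul_of_nonneg_left hle hc0.le]
  · -- y₀ < y_b ≤ y_f
    have h0b : y0 < yb := not_le.mp hb0
    have hinv : yf - yb ≤ (yf - yb) / c := by nlinarith
    have : c * (yf - y0) < yf - y0 := by nlinarith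
    linarith

/-! ### The combinatorial end of (T1): no permutation strictly decreases a function on a nonempty finite type -/

/-- No permutation of a nonempty finite type strictly decreases a real function along itself (evaluate at a
minimiser). [ours] -/
theorem no_strictly_decreasing_cycle {α : Type*} [Fintype α] [Nonempty α] (φ : Equiv.Perm α)
    (Δ : α → ℝ) (hdec : ∀ o, Δ (φ o) < Δ o) : False := by
  obtain ⟨o, ho⟩ := Finite.exists_min Δ
  exact absurd (ho (φ o)) (not_le.mpr (hdec o))

/-! ### F11: junction identity and block window -/

/-- Indicator of oddness as a real number. -/
def oddR (n : ℕ) : ℝ := if n % 2 = 1 then 1 else 0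

/-- `(−1)^n = 1 − 2·[n odd]`. [folklore] -/
lemma neg_one_pow_eq (n : ℕ) : ((-1 : ℝ) ^ n) = 1 - 2 * oddR n := by
  unfold oddR
  rcases Nat.even_or_odd n with h | h
  · rw [h.neg_one_pow]; rw [Nat.even_iff] at h; simp [h]
  · rw [h.neg_one_pow]; rw [Nat.odd_iff] at h; simp [h]; ring

/-- F11(b). Block invariants `u = ℓ − d − (σ + t)/2`; junction relation
`ℓ' = ℓ − σ·[n odd] + σ'·[n' odd]` (n = occupancy of the R-channel of the left block, n' = occupancy of the
L-channel of the right block); front signs `f_R = (−1)^n σ`, `f_L = (−1)^(n'+1) σ'`. Then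
`u' − u = (f_R + f_L)/2`. -/
theorem junction_identity (d t ℓ ℓ' σ σ' : ℝ) (n n' : ℕ)
    (hj : ℓ' = ℓ - σ * oddR n + σ' * oddR n') :
    (ℓ' - d - (σ' + t) / 2) - (ℓ - d - (σ + t) / 2)
      = (((-1 : ℝ) ^ n) * σ + ((-1 : ℝ) ^ (n' + 1)) * σ') / 2 := by
  rw [pow_succ, neg_one_pow_eq, neg_one_pow_eq, hj]
  ring

/-- F11(a), case σ = +t: the block levels `ℓ, ℓ − t, ℓ − d, ℓ − d − t` lie in `[u, u + d + t]` with
`u = ℓ − d − t` (here all four are listed explicitly). -/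
theorem block_window_pos (d t ℓ : ℝ) (hd : 0 < d) (ht : 0 < t) :
    ∀ x ∈ ({ℓ, ℓ - t, ℓ - d, ℓ - d - t} : Set ℝ), ℓ - d - t ≤ x ∧ x ≤ (ℓ - d - t) + d + t := by
  intro x hx
  simp only [Set.mem_insert_iff, Set.mem_singleton_iff] at hx
  rcases hx with rfl | rfl | rfl | rfl <;> constructor <;> linarith

/-- F11(a), case σ = −t: levels `ℓ, ℓ + t, ℓ − d, ℓ − d + t` lie in `[u, u + d + t]` with `u = ℓ − d`. -/
theorem block_window_neg (d t ℓ : ℝ) (hd : 0 < d) (ht : 0 < t) :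
    ∀ x ∈ ({ℓ, ℓ + t, ℓ - d, ℓ - d + t} : Set ℝ), ℓ - d ≤ x ∧ x ≤ (ℓ - d) + d + t := by
  intro x hx
  simp only [Set.mem_insert_iff, Set.mem_singleton_iff] at hx
  rcases hx with rfl | rfl | rfl | rfl <;> constructor <;> linarith

/-- (T2), counting form: if all block invariants are equal to `u` and every level on the line lies in the
window of its block, the range (sup − inf of the levels) is at most `d + t`. -/
theorem range_le_of_windows {ι : Type*} (d t u : ℝ) (lev : ι → ℝ)
    (hwin : ∀ i, u ≤ lev i ∧ lev i ≤ u + d + t) : ∀ i j, lev i - lev j ≤ d + t := by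
  intro i j
  have hi := hwin i; have hj := hwin j
  linarith [hi.2, hj.1]

end Summit.NavierStokesRegularity.FunctionalMining.OneNotch
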